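import Summits.CriticalPhenomena.PercolationContinuityZ3.Theorems.PercNearOneGluingNoHeavyLowerTailKnQuestion8AntitheticInsertion
import HarnessLib

/-!
# `NoHeavyLowerTail` (crux stmt-CriticalPhenomena-4575), antithetic vdBHK programme: TWIN ATOMS — the colouring-level dictionary of the twin bundle
# `Ω_{Q + d′}` (`d′` a new atom with the same strict up-set as the atom `d`) and the TWIN TRANSFER inequality

Support file (seat `prim-ineq-gen-7` gen 56; `--supports stmt-CriticalPhenomena-4575`).  No `sorry`, no definitions.  Companion of `AntitheticHat`
(hat over an atom) and `AntitheticInsertion` (root insertion).  Memo: run/shared/lean/prim/prim-ineq-gen-7/FINDING-TWIN-g56.md §1–2.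

SETTING (hypothesis style of `AntitheticHat` / `AntitheticInsertion`).  `E` is the ground set of a finite poset `Q` (any poset: a glued wedge may be part of it),
`down e` the strict down-sets, `u` an atom (`↓°u = ∅`), and `dead e` marks the elements of the strict up-set `↑°u` (`hdu : dead e → u ∈ ↓°e`).  The new element
`z = none : Option E` is a TWIN ATOM of `u`: `↓°z = ∅` (`hdZn`) and `↓°(some e) = some″↓°e` plus `z` exactly when `e` is dead (`hdZs`).  `leT`, `leZ` are the
explicit colouring orders of `Q` and of `Q + z` (the three conditions of FINDING-MULTISINK-g44 §0′: red interiors shrink, blue interiors grow, a red → blue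
flip is interior on both sides; `true` = red).  The colourings of `Q + z` fall into the four FIBRES `(colour of u, colour of z)`; `{z ≡ u}` (fibres `00, 11`, the
DIAGONAL) and `{z ≢ u}` (fibres `01, 10`, the ANTIDIAGONAL) are both stable under the colour swap.
* `AntitheticTwin.diag_iff_twin` — on the diagonal the order of `Q + z` is the order of `Q` on the restrictions: the diagonal is a copy of `Ω_Q`.
* `AntitheticTwin.off_iff_twin` — on the antidiagonal `leZ t t′` holds iff the pattern is frozen (`t u = t′ u`), the three conditions hold at every LIVE element
  for the restrictions, and every DEAD element that is red in `t` is red in `t′`: each antidiagonal fibre is the 'dead order' `M = Ω_{Q∖↑u} × (blue<red)^{↑°u}`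
  and the two fibres `01`, `10` are UNRELATED (unlike the insertion of `AntitheticInsertion.off_iff_ins`, where `z` is not an atom and the two blocks are linked).
* Companion file `AntitheticTwinTransfer`: the cross relations (`00 → 01/10`, `01/10 → 11` are the dead order `M`; `01 ∥ 10`) — together the
  TWIN STRUCTURE THEOREM: `Ω_{Q+z}` is the bundle over the square `00 < 01, 10 < 11` with fibres `L = Ω_Q ∩ {u red}`, `M`, `M`, `P = Ω_Q ∩ {u blue}`
  (memo §1; machine-exact on all 226 rooted posets with `≤ 5` elements) — and the TWIN TRANSFER inequality (AK of `M` + the twin slack inequality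
  `TSI(Q,u)` ⟹ AK of `Ω_{Q+z}`; memo §2–3).
-/

namespace Summit.CriticalPhenomena.PercolationContinuityZ3.Theorems

open Finset

namespace AntitheticTwin

variable {E : Type*}

/-- Bounded quantifier over the empty down-set `↓°z = ∅` of the twin atom. [this work] -/
theorem forall_downZ_none_twin (downZ : Option E → Finset (Option E)) (hdZn : ∀ o, o ∉ downZ none) (P : Option E → Prop) :
    (∀ o ∈ downZ none, P o) ↔ True :=
  ⟨fun _ => trivial, fun _ o ho => (hdZn o ho).elim⟩

/-- **TWIN DIAGONAL.**  With the twin `z` coloured like `u` in both colourings, the colouring order of `Q + z` is the colouring order of `Q` on the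
restrictions: the diagonal `{z ≡ u}` is a copy of `Ω_Q`. [this work] -/
theorem diag_iff_twin (down : E → Finset E) (u : E) (hu : ∀ d, d ∉ down u) (dead : E → Prop) (hdu : ∀ e, dead e → u ∈ down e)
    (downZ : Option E → Finset (Option E)) (hdZn : ∀ o, o ∉ downZ none)
    (hdZs : ∀ e o, o ∈ downZ (some e) ↔ (∃ d ∈ down e, o = some d) ∨ (o = none ∧ dead e))
    (leT : (E → Bool) → (E → Bool) → Prop)
    (hleT : ∀ s t, leT s t ↔
      ((∀ e, (t e = true ∧ ∀ d ∈ down e, t d = true) → (s e = true ∧ ∀ d ∈ down e, s d = true)) ∧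
       (∀ e, (s e = false ∧ ∀ d ∈ down e, s d = false) → (t e = false ∧ ∀ d ∈ down e, t d = false)) ∧
       (∀ e, s e = true → t e = false → ((∀ d ∈ down e, s d = true) ∧ (∀ d ∈ down e, t d = false)))))
    (leZ : (Option E → Bool) → (Option E → Bool) → Prop)
    (hleZ : ∀ s t, leZ s t ↔
      ((∀ o, (t o = true ∧ ∀ d ∈ downZ o, t d = true) → (s o = true ∧ ∀ d ∈ downZ o, s d = true)) ∧
       (∀ o, (s o = false ∧ ∀ d ∈ downZ o, s d = false) → (t o = false ∧ ∀ d ∈ downZ o, t d = false)) ∧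
       (∀ o, s o = true → t o = false → ((∀ d ∈ downZ o, s d = true) ∧ (∀ d ∈ downZ o, t d = false)))))
    (s s' : E → Bool) (t t' : Option E → Bool) (hts : ∀ e, t (some e) = s e) (hts' : ∀ e, t' (some e) = s' e)
    (htn : t none = s u) (htn' : t' none = s' u) :
    leZ t t' ↔ leT s s' := by
  have vac : ∀ (r : E → Bool) (b : Bool), (∀ d ∈ down u, r d = b) := fun r b d hd => (hu d hd).elim
  have HS := AntitheticInsertion.forall_downZ_some_ins down dead downZ hdZs
  have HN := forall_downZ_none_twin downZ hdZn
  -- the extra member `z ≡ u` of a dead down-set carries no information on the diagonal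
  have red : ∀ (r : E → Bool) (rz : Option E → Bool) (b : Bool), rz none = r u →
      ∀ e, ((∀ d ∈ down e, r d = b) ∧ (dead e → rz none = b)) ↔ (∀ d ∈ down e, r d = b) := by
    intro r rz b hrn e
    constructor
    · rintro ⟨h1, -⟩; exact h1
    · intro h; exact ⟨h, fun he => by rw [hrn]; exact h u (hdu e he)⟩
  rw [hleT, hleZ]
  constructor
  · rintro ⟨h1, h2, h3⟩
    refine ⟨fun e => ?_, fun e => ?_, fun e => ?_⟩
    · have h := h1 (some e); simp only [HS, red s t true htn, red s' t' true htn', hts, hts'] at h; exact h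
    · have h := h2 (some e); simp only [HS, red s t false htn, red s' t' false htn', hts, hts'] at h; exact h
    · have h := h3 (some e); simp only [HS, red s t true htn, red s' t' false htn', hts, hts'] at h; exact h
  · rintro ⟨h1, h2, h3⟩
    refine ⟨fun o => ?_, fun o => ?_, fun o => ?_⟩
    · cases o with
      | none =>
        simp only [HN, htn, htn', and_true]
        intro ha
        exact (h1 u ⟨ha, vac s' true⟩).1
      | some e => simp only [HS, red s t true htn, red s' t' true htn', hts, hts']; exact h1 e
    · cases o with
      | none =>
        simp only [HN, htn, htn', and_true]
        intro ha
        exact (h2 u ⟨ha, vac s false⟩).1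
      | some e => simp only [HS, red s t false htn, red s' t' false htn', hts, hts']; exact h2 e
    · cases o with
      | none =>
        simp only [HN, htn, htn', and_self]
        intro _ _; trivial
      | some e => simp only [HS, red s t true htn, red s' t' false htn', hts, hts']; exact h3 e

/-- **TWIN ANTIDIAGONAL.**  With `z` coloured unlike `u` in both colourings, `leZ t t′` holds iff (a) the pattern is frozen, `t u = t′ u` (two atoms of
different colours can never be recoloured: the fibres `01` and `10` are unrelated), (b) the three order conditions hold at every LIVE element for the
restrictions to `Q`, and (c) every DEAD element that is red in `t` is red in `t′` (dead elements form free chains blue < red): each antidiagonal fibre is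
ordered as `Ω_{Q∖↑u} × (blue<red)^{↑°u}`. [this work] -/
theorem off_iff_twin (down : E → Finset E) (u : E) (hu : ∀ d, d ∉ down u) (dead : E → Prop) (hdu : ∀ e, dead e → u ∈ down e)
    (downZ : Option E → Finset (Option E)) (hdZn : ∀ o, o ∉ downZ none)
    (hdZs : ∀ e o, o ∈ downZ (some e) ↔ (∃ d ∈ down e, o = some d) ∨ (o = none ∧ dead e))
    (leZ : (Option E → Bool) → (Option E → Bool) → Prop)
    (hleZ : ∀ s t, leZ s t ↔
      ((∀ o, (t o = true ∧ ∀ d ∈ downZ o, t d = true) → (s o = true ∧ ∀ d ∈ downZ o, s d = true)) ∧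
       (∀ o, (s o = false ∧ ∀ d ∈ downZ o, s d = false) → (t o = false ∧ ∀ d ∈ downZ o, t d = false)) ∧
       (∀ o, s o = true → t o = false → ((∀ d ∈ downZ o, s d = true) ∧ (∀ d ∈ downZ o, t d = false)))))
    (s s' : E → Bool) (t t' : Option E → Bool) (hts : ∀ e, t (some e) = s e) (hts' : ∀ e, t' (some e) = s' e)
    (htn : t none = !(s u)) (htn' : t' none = !(s' u)) :
    leZ t t' ↔
      (s u = s' u ∧
       ((∀ e, ¬ dead e → (s' e = true ∧ ∀ d ∈ down e, s' d = true) → (s e = true ∧ ∀ d ∈ down e, s d = true)) ∧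
        (∀ e, ¬ dead e → (s e = false ∧ ∀ d ∈ down e, s d = false) → (s' e = false ∧ ∀ d ∈ down e, s' d = false)) ∧
        (∀ e, ¬ dead e → s e = true → s' e = false → ((∀ d ∈ down e, s d = true) ∧ (∀ d ∈ down e, s' d = false)))) ∧
       (∀ e, dead e → s e = true → s' e = true)) := by
  have vac : ∀ (r : E → Bool) (b : Bool), (∀ d ∈ down u, r d = b) := fun r b d hd => (hu d hd).elim
  have hnu : ¬ dead u := fun h => hu u (hdu u h)
  have HS := AntitheticInsertion.forall_downZ_some_ins down dead downZ hdZs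
  have HN := forall_downZ_none_twin downZ hdZn
  -- on the antidiagonal a dead down-set is never monochromatic (it contains `u` and `z ≢ u`)
  have nomono : ∀ (r : E → Bool) (rz : Option E → Bool) (b : Bool), (∀ e, rz (some e) = r e) → rz none = !(r u) →
      ∀ e, dead e → ¬ ((∀ d ∈ down e, rz (some d) = b) ∧ (dead e → rz none = b)) := by
    intro r rz b hrs hrn e he ⟨h1, h2⟩
    have a1 := h1 u (hdu e he); rw [hrs] at a1
    have a2 := h2 he; rw [hrn, a1] at a2
    cases b <;> simp at a2
  -- at a live element the extra member is absent
  have live : ∀ (r : E → Bool) (rz : Option E → Bool) (b : Bool),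
      ∀ e, ¬ dead e → (((∀ d ∈ down e, r d = b) ∧ (dead e → rz none = b)) ↔ (∀ d ∈ down e, r d = b)) := by
    intro r rz b e he
    constructor
    · rintro ⟨h1, -⟩; exact h1
    · intro h; exact ⟨h, fun he' => (he he').elim⟩
  rw [hleZ]
  constructor
  · rintro ⟨h1, h2, h3⟩
    have L1 : ∀ e, ¬ dead e → (s' e = true ∧ ∀ d ∈ down e, s' d = true) → (s e = true ∧ ∀ d ∈ down e, s d = true) := by
      intro e he
      have h := h1 (some e)
      simp only [HS, live s t true e he, live s' t' true e he, hts, hts'] at h; exact h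
    have L2 : ∀ e, ¬ dead e → (s e = false ∧ ∀ d ∈ down e, s d = false) → (s' e = false ∧ ∀ d ∈ down e, s' d = false) := by
      intro e he
      have h := h2 (some e)
      simp only [HS, live s t false e he, live s' t' false e he, hts, hts'] at h; exact h
    refine ⟨?_, ⟨L1, L2, fun e he => ?_⟩, fun e he hse => ?_⟩
    · -- frozen pattern: `u` cannot turn blue → red (atom, condition 1 at `u`) nor red → blue (condition 2 at `z`)
      have hn := h2 none
      simp only [HN, htn, htn', and_true] at hn
      cases hsu : s u with
      | false =>
        cases hs'u : s' u with
        | false => rfl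
        | true =>
          have h0 := (L1 u hnu ⟨hs'u, vac s' true⟩).1
          rw [hsu] at h0; exact absurd h0 (by decide)
      | true =>
        cases hs'u : s' u with
        | true => rfl
        | false =>
          rw [hsu, hs'u] at hn
          exact absurd (hn (by decide)) (by decide)
    · have h := h3 (some e)
      simp only [HS, live s t true e he, live s' t' false e he, hts, hts'] at h; exact h
    · -- a dead element cannot turn red → blue
      by_contra hne
      have hs'e : s' e = false := by
        cases h' : s' e with
        | false => rfl
        | true => exact absurd h' hne
      have h := h3 (some e)
      rw [hts, hts'] at h
      have hh := (h hse hs'e).1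
      rw [HS] at hh
      exact nomono s t true hts htn e he hh
  · rintro ⟨hpat, ⟨h1, h2, h3⟩, hd⟩
    refine ⟨fun o => ?_, fun o => ?_, fun o => ?_⟩
    · cases o with
      | none =>
        simp only [HN, htn, htn', and_true]
        intro ha; rw [hpat]; exact ha
      | some e =>
        by_cases he : dead e
        · rintro ⟨-, hb⟩; rw [HS] at hb; exact (nomono s' t' true hts' htn' e he hb).elim
        · simp only [HS, live s t true e he, live s' t' true e he, hts, hts']; exact h1 e he
    · cases o with
      | none =>
        simp only [HN, htn, htn', and_true]
        intro ha; rw [← hpat]; exact ha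
      | some e =>
        by_cases he : dead e
        · rintro ⟨-, hb⟩; rw [HS] at hb; exact (nomono s t false hts htn e he hb).elim
        · simp only [HS, live s t false e he, live s' t' false e he, hts, hts']; exact h2 e he
    · cases o with
      | none =>
        simp only [HN, htn, htn', and_self]
        intro _ _; trivial
      | some e =>
        by_cases he : dead e
        · intro ha hb
          rw [hts] at ha; rw [hts'] at hb
          have h0 := hd e he ha; rw [h0] at hb; exact absurd hb (by decide)
        · simp only [HS, live s t true e he, live s' t' false e he, hts, hts']; exact h3 e he

end AntitheticTwin


end Summit.CriticalPhenomena.PercolationContinuityZ3.Theorems
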